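import Mathlib

/-!
# Weighted-ℓ¹ dissipativity of a block chain: the one-sided Euler step (solo-blind s81, §24.91 (T-a))

The tail of the leaf chain (modes `m > J`) is a block-tridiagonal system `ż_m = A_mm z_m + Σ_{m'} A_{mm'} z_{m'}`
with 2×2 real blocks.  Its decay rate in the weighted norm `|z|_ϑ = Σ_m ϑ_m ‖z_m‖₂` is read off COLUMN CONDITIONS
`ϑ_{m'} μ₂(A_{m'm'}) + Σ_{m ≠ m'} ϑ_m ‖A_{mm'}‖ ≤ -λ ϑ_{m'}`.  The algebraic heart of that statement is the explicit
one-sided Euler estimate below; the passage to `|z(t)|_ϑ ≤ e^{-λ(t-s)} |z(s)|_ϑ` (and the Duhamel form with forcing) is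
Grönwall's inequality for the lower-right Dini derivative (Mathlib `le_gronwallBound_of_liminf_deriv_right_le`).

* `euclidean_euler_step` — in a real inner-product space, `⟪A v, v⟫ ≤ μ ‖v‖²` and `‖A v‖ ≤ α ‖v‖` give
  `‖v + τ A v‖ ≤ (1 + τ μ + τ² α²) ‖v‖` for `0 ≤ τ`, `τ α ≤ 1` (the diagonal blocks; `μ` may be negative).
* `weightedL1_euler_step` — block version: diagonal one-sided Euler bounds + off-diagonal norm bounds + the column
  conditions give `Σ_m ϑ_m ‖z_m + τ (D_m z_m + Σ_{m'} O_{mm'} z_{m'})‖ ≤ (1 - τ λ + τ² β) Σ_m ϑ_m ‖z_m‖`.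
  No linearity of the block maps is used.
-/

namespace Summit.AnomalousDissipation.AnomalousDissipation.Theorems

open Finset

/-- **One-sided Euler step in a real inner-product space.**  If `⟪A v, v⟫ ≤ μ ‖v‖²` and `‖A v‖ ≤ α ‖v‖`, then for
`0 ≤ τ` with `τ α ≤ 1`: `‖v + τ • A v‖ ≤ (1 + τ μ + τ² α²) ‖v‖`.  (`μ` is the logarithmic-norm bound and may be negative;
the `τ²` term is the price of the explicit step; `0 ≤ α` follows from the hypotheses unless `v = 0`.) -/
theorem euclidean_euler_step {E : Type*} [NormedAddCommGroup E] [InnerProductSpace ℝ E]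
    (A : E → E) (μ α τ : ℝ) (hτ : 0 ≤ τ) (hτα : τ * α ≤ 1)
    (hμ : ∀ v, inner ℝ (A v) v ≤ μ * ‖v‖ ^ 2) (hA : ∀ v, ‖A v‖ ≤ α * ‖v‖) (v : E) :
    ‖v + τ • A v‖ ≤ (1 + τ * μ + τ ^ 2 * α ^ 2) * ‖v‖ := by
  have hv : 0 ≤ ‖v‖ := norm_nonneg v
  have hAv : 0 ≤ ‖A v‖ := norm_nonneg _
  -- μ ≥ -α from Cauchy–Schwarz is not needed as a hypothesis: we only use the two displayed bounds at `v`.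
  have hsq : ‖v + τ • A v‖ ^ 2 = ‖v‖ ^ 2 + 2 * (τ * inner ℝ (A v) v) + τ ^ 2 * ‖A v‖ ^ 2 := by
    rw [norm_add_sq_real, norm_smul, Real.norm_eq_abs, abs_of_nonneg hτ, real_inner_smul_right,
      real_inner_comm]
    ring
  -- lower bound on μ actually used: inner (A v) v ≥ -‖A v‖ ‖v‖ ≥ -α ‖v‖²
  have hcs : -(α * ‖v‖ ^ 2) ≤ inner ℝ (A v) v := by
    have h1 : |inner ℝ (A v) v| ≤ ‖A v‖ * ‖v‖ := abs_real_inner_le_norm _ _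
    have h2 : ‖A v‖ * ‖v‖ ≤ α * ‖v‖ * ‖v‖ := mul_le_mul_of_nonneg_right (hA v) hv
    have h3 := neg_abs_le (inner ℝ (A v) v)
    nlinarith
  have hmain : ‖v + τ • A v‖ ^ 2 ≤ ((1 + τ * μ + τ ^ 2 * α ^ 2) * ‖v‖) ^ 2 := by
    rw [hsq]
    have hin := hμ v
    have hAv2 : ‖A v‖ ^ 2 ≤ α ^ 2 * ‖v‖ ^ 2 := by
      have := hA v
      nlinarith
    -- reduce to: ‖v‖² (1 + 2τ m + τ²α²) ≤ ‖v‖² (1 + τ m + τ²α²)² with m := inner/‖v‖² ∈ [-α, μ]; expand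
    have hτ2 : 0 ≤ τ ^ 2 := sq_nonneg τ
    -- set q := inner ℝ (A v) v; we have -α‖v‖² ≤ q ≤ μ‖v‖²
    -- target after expansion: 2τ q + τ²‖Av‖² ≤ (2τμ + 2τ²α²)‖v‖² + (τμ + τ²α²)² ‖v‖²  — use q ≤ μ‖v‖², ‖Av‖² ≤ α²‖v‖²,
    -- and (τμ + τ²α²)² + τ²α² ≥ ... ≥ 0 handles the rest:  need τ²α²‖v‖² ≤ 2τ²α²‖v‖² + (τμ+τ²α²)²‖v‖², i.e. 0 ≤ τ²α² + (τμ+τ²α²)²: true.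
    nlinarith [mul_nonneg hτ2 (sq_nonneg α), sq_nonneg (τ * μ + τ ^ 2 * α ^ 2), mul_nonneg (mul_nonneg hτ2 (sq_nonneg α)) (sq_nonneg ‖v‖),
      mul_nonneg (sq_nonneg (τ * μ + τ ^ 2 * α ^ 2)) (sq_nonneg ‖v‖), mul_le_mul_of_nonneg_left hin hτ,
      mul_le_mul_of_nonneg_left hAv2 hτ2]
  -- the factor is nonnegative: 1 + τμ + τ²α² ≥ 1 - τα + τ²α² ≥ 0 (using μ ≥ -α when v ≠ 0; handle v = 0 separately)
  by_cases hv0 : ‖v‖ = 0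
  · have : v = 0 := norm_eq_zero.mp hv0
    subst this
    have hA0 : ‖A 0‖ ≤ 0 := by simpa using hA 0
    have : A 0 = 0 := norm_le_zero_iff.mp hA0
    simp [this]
  · have hvpos : 0 < ‖v‖ := lt_of_le_of_ne hv (Ne.symm hv0)
    have hα : 0 ≤ α := by
      by_contra hneg
      push Not at hneg
      have h1 := hA v
      nlinarith [norm_nonneg (A v), mul_neg_of_neg_of_pos hneg hvpos]
    have hμα : -α ≤ μ := by
      have := le_trans hcs (hμ v)
      have hv2 : 0 < ‖v‖ ^ 2 := by positivity
      nlinarith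
    have hfac : 0 ≤ 1 + τ * μ + τ ^ 2 * α ^ 2 := by nlinarith [mul_nonneg hτ hα, sq_nonneg (τ * α)]
    have hR : 0 ≤ (1 + τ * μ + τ ^ 2 * α ^ 2) * ‖v‖ := mul_nonneg hfac hv
    by_contra hlt
    push Not at hlt
    have hx : 0 ≤ ‖v + τ • A v‖ := norm_nonneg _
    nlinarith [hmain, mul_pos (sub_pos.mpr hlt) (by linarith : (0:ℝ) < ‖v + τ • A v‖ + (1 + τ * μ + τ ^ 2 * α ^ 2) * ‖v‖)]

/-- **Weighted-ℓ¹ one-sided Euler step for a block chain.**  Blocks indexed by `Fin K`; `D m` the diagonal block map of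
mode `m`, `O m m'` the coupling map from mode `m'` into mode `m` (in the application `O m m = 0`, not needed); weights
`ϑ ≥ 0`.  Hypotheses: the diagonal one-sided Euler bounds `‖v + τ D_m v‖ ≤ (1 + τ μ_m + τ² a_m) ‖v‖`, the coupling bounds
`‖O_{mm'} v‖ ≤ c_{mm'} ‖v‖`, the COLUMN CONDITIONS `ϑ_{m'} μ_{m'} + Σ_m ϑ_m c_{mm'} ≤ -λ ϑ_{m'}` and `a_{m'} ≤ β`.  Conclusion:
`Σ_m ϑ_m ‖z_m + τ (D_m z_m + Σ_{m'} O_{mm'} z_{m'})‖ ≤ (1 - τ λ + τ² β) Σ_m ϑ_m ‖z_m‖` for every `z` and `τ ≥ 0`. -/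
theorem weightedL1_euler_step {K : ℕ} {E : Type*} [SeminormedAddCommGroup E] [NormedSpace ℝ E]
    (ϑ μ a : Fin K → ℝ) (c : Fin K → Fin K → ℝ) (D : Fin K → E → E) (O : Fin K → Fin K → E → E)
    (τ lam β : ℝ) (hτ : 0 ≤ τ) (hϑ : ∀ m, 0 ≤ ϑ m)
    (hD : ∀ m v, ‖v + τ • D m v‖ ≤ (1 + τ * μ m + τ ^ 2 * a m) * ‖v‖)
    (hO : ∀ m m' v, ‖O m m' v‖ ≤ c m m' * ‖v‖)
    (hcol : ∀ m', ϑ m' * μ m' + ∑ m, ϑ m * c m m' ≤ -lam * ϑ m')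
    (hβ : ∀ m', a m' ≤ β) (z : Fin K → E) :
    ∑ m, ϑ m * ‖z m + τ • (D m (z m) + ∑ m', O m m' (z m'))‖
      ≤ (1 - τ * lam + τ ^ 2 * β) * ∑ m, ϑ m * ‖z m‖ := by
  -- pointwise: ‖z_m + τ(D_m z_m + Σ O)‖ ≤ (1 + τμ_m + τ²a_m)‖z_m‖ + τ Σ_{m'} c_{mm'} ‖z_{m'}‖
  have hpt : ∀ m, ‖z m + τ • (D m (z m) + ∑ m', O m m' (z m'))‖
      ≤ (1 + τ * μ m + τ ^ 2 * a m) * ‖z m‖ + τ * ∑ m', c m m' * ‖z m'‖ := by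
    intro m
    have hsplit : z m + τ • (D m (z m) + ∑ m', O m m' (z m')) =
        (z m + τ • D m (z m)) + τ • ∑ m', O m m' (z m') := by
      rw [smul_add]; abel
    rw [hsplit]
    refine le_trans (norm_add_le _ _) (add_le_add (hD m (z m)) ?_)
    rw [norm_smul, Real.norm_eq_abs, abs_of_nonneg hτ]
    refine mul_le_mul_of_nonneg_left (le_trans (norm_sum_le _ _) (sum_le_sum fun m' _ => hO m m' (z m'))) hτ
  -- sum with weights
  have hsum : ∑ m, ϑ m * ‖z m + τ • (D m (z m) + ∑ m', O m m' (z m'))‖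
      ≤ ∑ m, ϑ m * ((1 + τ * μ m + τ ^ 2 * a m) * ‖z m‖ + τ * ∑ m', c m m' * ‖z m'‖) :=
    sum_le_sum fun m _ => mul_le_mul_of_nonneg_left (hpt m) (hϑ m)
  refine le_trans hsum ?_
  -- swap the double sum: Σ_m ϑ_m τ Σ_{m'} c_{mm'} ‖z_{m'}‖ = τ Σ_{m'} (Σ_m ϑ_m c_{mm'}) ‖z_{m'}‖
  have hswap : ∑ m, ϑ m * (τ * ∑ m', c m m' * ‖z m'‖) = τ * ∑ m', (∑ m, ϑ m * c m m') * ‖z m'‖ := by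
    calc ∑ m, ϑ m * (τ * ∑ m', c m m' * ‖z m'‖) = ∑ m, ∑ m', τ * (ϑ m * c m m' * ‖z m'‖) := by
          refine sum_congr rfl fun m _ => ?_
          rw [mul_sum, mul_sum]
          exact sum_congr rfl fun m' _ => by ring
      _ = ∑ m', ∑ m, τ * (ϑ m * c m m' * ‖z m'‖) := sum_comm
      _ = τ * ∑ m', (∑ m, ϑ m * c m m') * ‖z m'‖ := by
          rw [mul_sum]
          exact sum_congr rfl fun m' _ => by rw [sum_mul, mul_sum]
  have hlhs : ∑ m, ϑ m * ((1 + τ * μ m + τ ^ 2 * a m) * ‖z m‖ + τ * ∑ m', c m m' * ‖z m'‖)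
      = ∑ m, ϑ m * ((1 + τ * μ m + τ ^ 2 * a m) * ‖z m‖) + τ * ∑ m', (∑ m, ϑ m * c m m') * ‖z m'‖ := by
    rw [← hswap, ← sum_add_distrib]
    refine sum_congr rfl fun m _ => by ring
  rw [hlhs]
  -- use the column conditions termwise in m'
  have hcolz : τ * ∑ m', (∑ m, ϑ m * c m m') * ‖z m'‖ ≤ τ * ∑ m', (-lam * ϑ m' - ϑ m' * μ m') * ‖z m'‖ := by
    refine mul_le_mul_of_nonneg_left (sum_le_sum fun m' _ => ?_) hτ
    exact mul_le_mul_of_nonneg_right (by linarith [hcol m']) (norm_nonneg _)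
  have hdiag : ∑ m, ϑ m * ((1 + τ * μ m + τ ^ 2 * a m) * ‖z m‖)
      ≤ ∑ m, ϑ m * ((1 + τ * μ m + τ ^ 2 * β) * ‖z m‖) := by
    refine sum_le_sum fun m _ => mul_le_mul_of_nonneg_left ?_ (hϑ m)
    refine mul_le_mul_of_nonneg_right ?_ (norm_nonneg _)
    nlinarith [hβ m, sq_nonneg τ]
  calc ∑ m, ϑ m * ((1 + τ * μ m + τ ^ 2 * a m) * ‖z m‖) + τ * ∑ m', (∑ m, ϑ m * c m m') * ‖z m'‖
      ≤ ∑ m, ϑ m * ((1 + τ * μ m + τ ^ 2 * β) * ‖z m‖) + τ * ∑ m', (-lam * ϑ m' - ϑ m' * μ m') * ‖z m'‖ :=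
        add_le_add hdiag hcolz
    _ = (1 - τ * lam + τ ^ 2 * β) * ∑ m, ϑ m * ‖z m‖ := by
        rw [mul_sum, mul_sum, ← sum_add_distrib]
        exact sum_congr rfl fun m _ => by ring

end Summit.AnomalousDissipation.AnomalousDissipation.Theorems
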